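import Summits.QuantumFields.YangMills.Theorems.BalabanUVNodesK1V7RDefs
import Summits.QuantumFields.BalabanUV.Beta.EriceFlowEnclosureB12AsPrintedPointwiseFadingRunRows

/-!
# BalabanUVNodes ∕ K1⁸ `StabilityBRunRowsAtRecordR13SepCoPH` (stmt-QuantumFields-26907, crux r3 DECIDING, route rev 27) — A NEW SUPPLIER CLASS FOR THE ROWS `RunRowsCont13 F θ`:
# node U2's COUPLING-CHART LETTERS ∕ THE AS-PRINTED [I] THEOREM 2 INTERFACE AT THE TUPLE ⟹ the rows, ANCHOR-FREE, JET-FREE, DRIFT-FREE, CAP-FREE (and, on two of the roads, NE4-FREE)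

β-flow team (pub-balaban), PROVER 2 = lower ∕ positivity side (unit `b2b-balaban-beta-bflow-p2`, gen 50), `--kind proof --supports stmt-QuantumFields-26907 --as helper` (the successor key
of record for SUPPLIERS of these rows, `…Theorems.BalabanUVNodesK1R8RowsDefs` header); COUNT-NEUTRAL.  The kernel is the β-flow team's part 12
`Summits/QuantumFields/BalabanUV/Beta/EriceFlowEnclosureB12AsPrintedPointwiseFadingRunRows` (the rows ∃-shape over an ABSTRACT `β : FlowStep.HBeta`); THIS FILE keys it to the record's β
`β_θ := Node00.betaOfRecord₁₃ F 2 θ.toStage13Params` at a Stage-13 tuple and reads the result into DEF-1's names BY NAME (`runRowsCont13_iff_inline`, `rowsContAll_of_adm`,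
`endpointExistence_of_runRowsCont13`, `endpointGivenBR13SepCoPH_of_rowsContAll`, `stabilityBRunRowsAtRecordR13SepCoPH_of_k17_rowsContAll` — nothing of DEF-1's, dag-n24's, dag-n17's or
b2b-an4's is restated or modified).

WHY A NEW CLASS.  The supplier roads of record for K1⁸'s last conjunct key the remainder sequence `b` to NAMED ONE-LOOP JETS (`beta0OfJs F κ`, DEF-1's per-scale `ScaleAnchor`; dag-n17's N17 road)
or to row D4's (190)-chain ∕ corner pair ∕ weak currency (b2b-an4), and get the partial-sum floor from a (D1) ONE-LOOP DRIFT with the cap `r ≤ s` (DEF-1's ★).  The roads below use NONE of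
these: under node U2's moduli `HistLipschitz Λ γ β_θ` + `FadingMemory C ρ Λ` the record's OWN constant-history values `β_θ,k+1(γ₀,…,γ₀)` serve as the remainder sequence with radius
`Cγ₀∕(1−θ)` PROPORTIONAL TO THE LEVEL, (C) holds at EVERY level, and the floor comes from (α) a displayed family of (0.31)-runs (the TYPED [I] Theorem 2 at ONE endpoint) — NE4-FREE —,
or (β) NE4 `ScaleShiftRate c ρ γ β_θ` + the β-flow team's ONE asymptotic number `b⋆ > 0` (then `b ≡ b⋆` and `M = c∕(1−ρ)²` level-free), or (γ) node U2's eventual letter `EventualLowerH`.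
The as-printed road (§2): if `β_θ` is the β-field of a `B12BetaAsPrinted.Setting` carrying the statement-exact `Theorem2Statement` + prover 1's binder `hrg` + the moduli, the rows hold.

WHAT IS HERE (theorems only; 0 `def`, 0 `sorry`, standard axioms; every letter DISPLAYED, inhabited at NO θ here — instance 0∕1):
§1 per tuple: `runRowsCont13_of_moduli_runs` (NE4-free), `runRowsCont13_of_moduli_NE4_bstar_pos`, `runRowsCont13_of_moduli_NE4_at_level`, `runRowsCont13_of_moduli_eventualLowerH`;
   END at the datum from the letters: `endpointExistence_of_moduli_runs` (DEF-1's per-tuple use form BY NAME).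
§1′ generic (`β : HBeta`): `starInputs_of_moduli_NE4` — under the moduli + NE4 + `b⋆`, on every level `2Cγ₀ ≤ b⋆(1−ρ)` the FOUR inputs of DEF-1's ★
   `…K2NamedJetsRunRemAt.endpointExistence_of_drift_runConstRemainder_survCont` hold with `b k = β_{k+1}(γ₀,…,γ₀)` (drift slope `betaInf β (γ₀,γ₀,…)`, defect `c∕(1−ρ)²`, radius `Cγ₀∕(1−ρ)`,
   the CAP `r ≤ s` automatic); hence `endpointExistence_of_moduli_NE4_star` for ANY forward-generated construction currying `β` — DEF-1's ★ road fed ANCHOR-FREE.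
§1″ THE REGISTERED STUB CURRENCY (K1 v7ᴿ: match-free run rows `∃ b r γ₀ B M, … ∧ (∀ k, b k ≤ B) ∧ …` + (C)): `matchFreeRunRowsCont_of_moduli_NE4` (b ≡ B := b⋆, so the ceiling to key the world at
   is `c := b⋆ + 2Cγ₀∕(1−ρ) + c∕(1−ρ)`), `runRowsContAtSomeRecord13PWS_of_ceilingKeyedRung1_moduli_NE4` (dag-n24-w1's CEILING-KEYED rung-1 family at the tuple + the letters ⟹ dag-n24-w1's
   registered stub-3 text `K1V7RDefs.RunRowsContAtSomeRecord13PWS F` — the match `B + r ≤ w.βup` discharged by choosing the world at that ceiling, as in `runRowsText_of_ceilingKeyedRung1_of_rows`).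
§2 the as-printed interface at the tuple: `runRowsCont13_of_typedTheorem2` (`S.β = β_θ`, `Theorem2Statement S hL`, `hrg`, moduli ⟹ rows; NE4-free), `runRowsCont13_of_typedTheorem2_NE4`.
§3 the programme: `rowsContAll_of_moduliRunsAll` (letters at every admissible tuple with provisos ⟹ DEF-1's `RowsContAll`), hence the aside decl K2⁷ (`endpointGivenBR13SepCoPH_of_moduliRunsAll`)
   and K1⁸ from K1⁷ (`stabilityBRunRowsAtRecordR13SepCoPH_of_k17_moduliRunsAll`) BY NAME — CONDITIONAL.

HONEST SCOPE.  Implications only; NOTHING of Bałaban's analysis is asserted: node U2's moduli ∕ NE4 ∕ eventual letter are HYPOTHESIS SHAPES, NOT PRINTED ([I] p. 298 states the history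
dependence only; p. 264 *"We will investigate other properties in a separate paper"*; GAPS G-t4-U2-1∕-2); `Theorem2Statement` is the statement-exact typing of a theorem STATED WITHOUT PROOF in
print (p. 259); the (0.31)-run family is displayed.  NO stub of K1 v7ᴿ is proved (its rows at the WITNESS for Bałaban's β are [II] (2.41)-class content); K0⁷ 20541 ∕ K1⁸ 26907 ∕ K3⁷ 20544
OPEN; counts unmoved (typed 28∕28 · discharged 5∕27); (D1) ∕ (D4) ∕ (C) ∕ NE4 NOT discharged; discharges NOTHING of `BetaPertH`.  Route R4 closes ONLY the conditional finite-𝕋⁴ rung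
`BalabanLadder.UV` — NOT continuum, NOT ℝ⁴, NOT OS, NOT a mass gap, NOT Clay.  Sources (context only; nothing printed is used as a hypothesis): [I] = [Balaban1987RG1] CMP **109** (1987): Thm 2
+ (0.31) p. 259, (0.20) p. 256, Thm 3 p. 264, §1 pp. 263–264, (5.10) p. 293, §5 p. 298; [II] = [Balaban1988RG2Cluster] CMP **116** (1988): (2.41) p. 21; [V] = [Balaban1989LargeFieldII]
CMP **122** (1989): Thm 1 p. 355.
-/

open scoped Matrix.Norms.L2Operator

namespace Summit.QuantumFields.YangMills.Theorems.BalabanUVNodesK1RunRowsOfU2Letters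

open Literature.MathematicalPhysics.QuantumFieldTheory.Balaban1983to89
open Literature.MathematicalPhysics.QuantumFieldTheory.Balaban1983to89.B12BetaAsPrinted (Setting Theorem2Statement)
open Literature.MathematicalPhysics.QuantumFieldTheory.Balaban1983to89.FlowStep (HBeta prefixOf Box RGEqH)
open Literature.MathematicalPhysics.QuantumFieldTheory.Balaban1983to89.DagBinding (EndpointExistence ForwardGenerated WorldP Nodes leavesP)
open Literature.MathematicalPhysics.QuantumFieldTheory.Balaban1983to89.Beta.Drift (OneLoopDrift)
open Summit.QuantumFields.YangMills.Theorems.BalabanUVNodesK2NamedJetsRunRemAt (RunConstRemainder SurvCont endpointExistence_of_drift_runConstRemainder_survCont)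
open Literature.MathematicalPhysics.QuantumFieldTheory.Balaban1983to89.T4Continuum (T4Family)
open Literature.MathematicalPhysics.QuantumFieldTheory.Balaban1983to89.T4CouplingMatching (HistLipschitz FadingMemory ScaleShiftRate EventualLowerH)
open Literature.MathematicalPhysics.QuantumFieldTheory.Balaban1983to89.T4BetaStationary (betaInf)
open Summit.QuantumFields.YangMills.Theorems.BalabanUVNodesK1R8RowsDefs
  (RunRowsCont13 RowsContAll runRowsCont13_iff_inline rowsContAll_of_adm endpointExistence_of_runRowsCont13 endpointGivenBR13SepCoPH_of_rowsContAll
    stabilityBRunRowsAtRecordR13SepCoPH_of_k17_rowsContAll)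
open Summit.QuantumFields.YangMills.Theses.BalabanUVNodes (StabilityBAtRecordR13SepCoPH EndpointGivenBR13SepCoPH StabilityBRunRowsAtRecordR13SepCoPH)
open Summit.QuantumFields.YangMills.Theorems.K1V6Defs (RecordS)
open Summit.QuantumFields.YangMills.Theorems.K1V7RDefs (RunRowsContAtSomeRecord13PWS)
open Summit.QuantumFields.BalabanUV.Beta.EriceFlowEnclosureB12AsPrintedPointwiseFadingRunRows

noncomputable section

variable {F : T4Family}

/-! ## §1 Per tuple: node U2's letters on the record's β ⟹ `RunRowsCont13 F θ` -/

/-- **NE4-FREE ROAD**: at a Stage-13 tuple `θ`, node U2's moduli `HistLipschitz Λ γ β_θ` + `FadingMemory C ρ Λ` (0 ≤ ρ < 1, 0 ≤ C, 0 < γ) for the record's β and a displayed family of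
(0.31)-runs of `β_θ` in ]0, γ] at slopes `0 < s ≤ s′` (one per depth) ⟹ `RunRowsCont13 F θ` (the kernel's `rowsTriple_of_runs_moduli` read through DEF-1's `runRowsCont13_iff_inline`):
`b k = β_θ,k+1(γ₀,…,γ₀)`, `r = Cγ₀∕(1−ρ)`, NO anchor ∕ jets ∕ drift ∕ cap.  CONDITIONAL on the displayed letters. [cite: Balaban1987RG1, Thm 2 (0.31) p.259, Thm 3 p.264, §1 pp.263–264, (5.10) p.293, §5 p.298] -/
theorem runRowsCont13_of_moduli_runs (θ : Node00.Stage13HParams F 2) {γ C ρ s s' : ℝ} {Λ : ℕ → ℕ → ℝ}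
    (hL : HistLipschitz Λ γ (Node00.betaOfRecord₁₃ F 2 θ.toStage13Params)) (hΛ : FadingMemory C ρ Λ)
    (hρ0 : 0 ≤ ρ) (hρ1 : ρ < 1) (hC : 0 ≤ C) (hγ : 0 < γ) (hs : 0 < s)
    (hruns : ∀ K : ℕ, ∃ r : ℕ → ℝ, RGEqH K (Node00.betaOfRecord₁₃ F 2 θ.toStage13Params) r ∧ Step.InInterval γ K r ∧
      Step.Discrete031 s s' K (r K) r) :
    RunRowsCont13 F θ := by
  obtain ⟨b, r, γ₀, M, hγ₀, -, hi, hiv, hC'⟩ := rowsTriple_of_runs_moduli hL hΛ hρ0 hρ1 hC hγ hs hruns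
  exact (runRowsCont13_iff_inline F θ).mpr ⟨b, r, γ₀, M, hγ₀, hi, hiv, hC'⟩

/-- **NE4 ROAD WITH THE CONSTANT REMAINDER SEQUENCE**: the moduli + `ScaleShiftRate c ρ γ β_θ` + the β-flow team's asymptotic constant `b⋆` of `β_θ` (its displayed property) with `0 < b⋆`
⟹ `RunRowsCont13 F θ` with `b ≡ b⋆`, `r = 2Cγ₀∕(1−ρ) + c∕(1−ρ)`, `M = c∕(1−ρ)²` (`rowsTriple_of_moduli_NE4_bstar_pos`).  CONDITIONAL. [cite: Balaban1987RG1, Thm 2 p.259, Thm 3 p.264, §1 pp.263–264, (5.10) p.293, §5 p.298] -/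
theorem runRowsCont13_of_moduli_NE4_bstar_pos (θ : Node00.Stage13HParams F 2) {γ C c ρ : ℝ} {Λ : ℕ → ℕ → ℝ}
    (hL : HistLipschitz Λ γ (Node00.betaOfRecord₁₃ F 2 θ.toStage13Params)) (hΛ : FadingMemory C ρ Λ)
    (hS : ScaleShiftRate c ρ γ (Node00.betaOfRecord₁₃ F 2 θ.toStage13Params)) (hρ0 : 0 ≤ ρ) (hρ1 : ρ < 1) (hC : 0 ≤ C) (hγ : 0 < γ)
    {bstar : ℝ} (hb : ∀ u : ℝ, 0 < u → u ≤ γ →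
      |betaInf (Node00.betaOfRecord₁₃ F 2 θ.toStage13Params) (fun _ : ℕ => u) - bstar| ≤ C * u / (1 - ρ)) (hpos : 0 < bstar) :
    RunRowsCont13 F θ := by
  obtain ⟨b, r, γ₀, M, hγ₀, -, -, hi, hiv, hC'⟩ := rowsTriple_of_moduli_NE4_bstar_pos hL hΛ hS hρ0 hρ1 hC hγ hb hpos
  exact (runRowsCont13_iff_inline F θ).mpr ⟨b, r, γ₀, M, hγ₀, hi, hiv, hC'⟩

/-- **NE4 ROAD, LEVEL-RESOLVED**: at ANY level `0 < γ₀ ≤ γ` with `2Cγ₀ ≤ b⋆(1−ρ)` the rows hold on that level (`rows_at_level_of_moduli_NE4`), hence `RunRowsCont13 F θ` witnessed AT `γ₀`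
with `b ≡ b⋆` (no positivity hypothesis displayed: the level condition carries it). CONDITIONAL. [cite: Balaban1987RG1, Thm 2 p.259, Thm 3 p.264, §1 pp.263–264, (5.10) p.293, §5 p.298] -/
theorem runRowsCont13_of_moduli_NE4_at_level (θ : Node00.Stage13HParams F 2) {γ C c ρ : ℝ} {Λ : ℕ → ℕ → ℝ}
    (hL : HistLipschitz Λ γ (Node00.betaOfRecord₁₃ F 2 θ.toStage13Params)) (hΛ : FadingMemory C ρ Λ)
    (hS : ScaleShiftRate c ρ γ (Node00.betaOfRecord₁₃ F 2 θ.toStage13Params)) (hρ0 : 0 ≤ ρ) (hρ1 : ρ < 1) (hC : 0 ≤ C)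
    {bstar : ℝ} (hb : ∀ u : ℝ, 0 < u → u ≤ γ →
      |betaInf (Node00.betaOfRecord₁₃ F 2 θ.toStage13Params) (fun _ : ℕ => u) - bstar| ≤ C * u / (1 - ρ))
    {γ₀ : ℝ} (hγ₀ : 0 < γ₀) (hγ₀γ : γ₀ ≤ γ) (hsmall : 2 * C * γ₀ ≤ bstar * (1 - ρ)) :
    RunRowsCont13 F θ := by
  obtain ⟨hi, hiv, hC'⟩ := rows_at_level_of_moduli_NE4 hL hΛ hS hρ0 hρ1 hC hb hγ₀ hγ₀γ hsmall
  exact (runRowsCont13_iff_inline F θ).mpr ⟨fun _ => bstar, _, γ₀, _, hγ₀, hi, hiv, hC'⟩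

/-- **node U2's EVENTUAL LETTER ROAD**: the moduli on ]0, γ] + `EventualLowerH b γ₀ k₀ β_θ` with `0 ≤ b` on a level `0 < γ₀ ≤ γ` + a displayed floor `−B` (`0 ≤ B`) on the boxes of the
first `k₀` scales ⟹ `RunRowsCont13 F θ` at level `γ₀` ((i) and (C) from the moduli, (iv) with `M = k₀B` via `betaPartialSumsLowerH_of_eventualLowerH` + pub-balaban-gaps'
`runwisePS_of_betaPartialSumsLowerH`).  CONDITIONAL. [cite: Balaban1987RG1, Thm 2 p.259, Thm 3 p.264, §1 pp.263–264, (5.10) p.293] -/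
theorem runRowsCont13_of_moduli_eventualLowerH (θ : Node00.Stage13HParams F 2) {γ C ρ b γ₀ B : ℝ} {Λ : ℕ → ℕ → ℝ} {k₀ : ℕ}
    (hL : HistLipschitz Λ γ (Node00.betaOfRecord₁₃ F 2 θ.toStage13Params)) (hΛ : FadingMemory C ρ Λ)
    (hρ0 : 0 ≤ ρ) (hρ1 : ρ < 1) (hC : 0 ≤ C) (hγ₀ : 0 < γ₀) (hγ₀γ : γ₀ ≤ γ)
    (hE : EventualLowerH b γ₀ k₀ (Node00.betaOfRecord₁₃ F 2 θ.toStage13Params)) (hb0 : 0 ≤ b) (hB : 0 ≤ B)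
    (hfirst : ∀ (j : ℕ) (v : Fin (j + 1) → ℝ), j < k₀ → v ∈ Box γ₀ j → -B ≤ Node00.betaOfRecord₁₃ F 2 θ.toStage13Params j v) :
    RunRowsCont13 F θ :=
  (runRowsCont13_iff_inline F θ).mpr
    ⟨_, _, γ₀, _, hγ₀, runRem_constHist_of_moduli hL hΛ hρ0 hρ1 hC hγ₀ hγ₀γ,
      Summit.QuantumFields.BalabanUV.Gaps.EndRunwiseCone.runwisePS_of_betaPartialSumsLowerH hγ₀
        (betaPartialSumsLowerH_of_eventualLowerH hE hb0 hB hfirst),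
      survCont_of_moduli hL hγ₀ hγ₀γ⟩

/-- **END AT THE DATUM FROM THE LETTERS (NE4-free road)**: at a tuple with provisos, the moduli + a (0.31)-run family for `β_θ` ⟹ endpoint existence of the datum of record's construction
(DEF-1's per-tuple use form `endpointExistence_of_runRowsCont13` BY NAME — dag-n13-w4's Tietze + run-wise shooting road underneath).  CONDITIONAL; K2⁷ ∕ K1⁸ NOT closed.
[cite: Balaban1987RG1, Thm 2 p.259 (first sentence), Thm 3 p.264, (5.10) p.293, §1 pp.263–264] -/
theorem endpointExistence_of_moduli_runs (θ : Node00.Stage13HParams F 2) (hP : θ.Provisos₁₃SepCoPH F 2) {γ C ρ s s' : ℝ} {Λ : ℕ → ℕ → ℝ}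
    (hL : HistLipschitz Λ γ (Node00.betaOfRecord₁₃ F 2 θ.toStage13Params)) (hΛ : FadingMemory C ρ Λ)
    (hρ0 : 0 ≤ ρ) (hρ1 : ρ < 1) (hC : 0 ≤ C) (hγ : 0 < γ) (hs : 0 < s)
    (hruns : ∀ K : ℕ, ∃ r : ℕ → ℝ, RGEqH K (Node00.betaOfRecord₁₃ F 2 θ.toStage13Params) r ∧ Step.InInterval γ K r ∧
      Step.Discrete031 s s' K (r K) r) :
    EndpointExistence (Node00.datumOfRecord₁₃SepCoPH F 2 θ hP).C.toB12 :=
  endpointExistence_of_runRowsCont13 θ hP (runRowsCont13_of_moduli_runs θ hL hΛ hρ0 hρ1 hC hγ hs hruns)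

/-! ## §1′ Generic: the β-flow letters feed DEF-1's ★ road anchor-free (the constant-history values as drifting jets, the cap automatic) -/

section Star

variable {β : HBeta} {γ C c ρ : ℝ} {Λ : ℕ → ℕ → ℝ}

/-- **THE FOUR INPUTS OF DEF-1's ★ FROM THE LETTERS, ANCHOR-FREE.**  Under node U2's moduli `HistLipschitz Λ γ β` + `FadingMemory C ρ Λ` (0 ≤ ρ < 1, 0 ≤ C), NE4 `ScaleShiftRate c ρ γ β`
and the β-flow team's asymptotic constant `b⋆` (displayed property `hb`), on EVERY level `0 < γ₀ ≤ γ` with `2Cγ₀ ≤ b⋆(1−ρ)`: (drift) `OneLoopDrift (betaInf β (γ₀,…)) (c∕(1−ρ)²) (k ↦ β_{k+1}(γ₀,…,γ₀))`,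
(remainder) `RunConstRemainder β (k ↦ β_{k+1}(γ₀,…,γ₀)) (Cγ₀∕(1−ρ)) γ₀`, (cap) `Cγ₀∕(1−ρ) ≤ betaInf β (γ₀,…)`, (C) `SurvCont β γ₀` — DEF-1's names, the kernel's part 12 §1–§2 underneath;
NO `ScaleAnchor`, NO named jets `beta0OfJs`, NO (D1) letter.  CONDITIONAL on the displayed letters. [cite: Balaban1987RG1, Thm 2 p.259, (1.22) p.264, Thm 3 p.264, §1 pp.263–264, §5 p.298] -/
theorem starInputs_of_moduli_NE4 (hL : HistLipschitz Λ γ β) (hΛ : FadingMemory C ρ Λ) (hS : ScaleShiftRate c ρ γ β)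
    (hρ0 : 0 ≤ ρ) (hρ1 : ρ < 1) (hC : 0 ≤ C) {bstar : ℝ}
    (hb : ∀ u : ℝ, 0 < u → u ≤ γ → |betaInf β (fun _ : ℕ => u) - bstar| ≤ C * u / (1 - ρ))
    {γ₀ : ℝ} (hγ₀ : 0 < γ₀) (hγ₀γ : γ₀ ≤ γ) (hsmall : 2 * C * γ₀ ≤ bstar * (1 - ρ)) :
    OneLoopDrift (betaInf β (fun _ : ℕ => γ₀)) (c / (1 - ρ) ^ 2) (fun k => β k (fun _ : Fin (k + 1) => γ₀)) ∧
      RunConstRemainder β (fun k => β k (fun _ : Fin (k + 1) => γ₀)) (C * γ₀ / (1 - ρ)) γ₀ ∧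
      C * γ₀ / (1 - ρ) ≤ betaInf β (fun _ : ℕ => γ₀) ∧ SurvCont β γ₀ := by
  have h1ρ : 0 < 1 - ρ := by linarith
  refine ⟨oneLoopDrift_constHist_of_NE4 hS hρ0 hρ1 hγ₀ hγ₀γ, runRem_constHist_of_moduli hL hΛ hρ0 hρ1 hC hγ₀ hγ₀γ, ?_,
    survCont_of_moduli hL hγ₀ hγ₀γ⟩
  have h := (abs_le.mp (hb γ₀ hγ₀ hγ₀γ)).1
  have h2 : 2 * C * γ₀ / (1 - ρ) ≤ bstar := by rw [div_le_iff₀ h1ρ]; exact hsmall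
  have e : 2 * C * γ₀ / (1 - ρ) = C * γ₀ / (1 - ρ) + C * γ₀ / (1 - ρ) := by ring
  linarith

/-- **… HENCE ENDPOINT EXISTENCE BY DEF-1's ★ FOR ANY FORWARD-GENERATED CONSTRUCTION CURRYING `β`**, from the moduli + NE4 + `b⋆` on any level with `2Cγ₀ ≤ b⋆(1−ρ)`
(`…K2NamedJetsRunRemAt.endpointExistence_of_drift_runConstRemainder_survCont` BY NAME on `starInputs_of_moduli_NE4`).  CONDITIONAL; nothing closed.
[cite: Balaban1987RG1, Thm 2 p.259 (first sentence), Thm 3 p.264, (5.10) p.293, §1 pp.263–264] -/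
theorem endpointExistence_of_moduli_NE4_star {Cn : B12.Construction} (hgen : ForwardGenerated Cn β)
    (hL : HistLipschitz Λ γ β) (hΛ : FadingMemory C ρ Λ) (hS : ScaleShiftRate c ρ γ β)
    (hρ0 : 0 ≤ ρ) (hρ1 : ρ < 1) (hC : 0 ≤ C) {bstar : ℝ}
    (hb : ∀ u : ℝ, 0 < u → u ≤ γ → |betaInf β (fun _ : ℕ => u) - bstar| ≤ C * u / (1 - ρ))
    {γ₀ : ℝ} (hγ₀ : 0 < γ₀) (hγ₀γ : γ₀ ≤ γ) (hsmall : 2 * C * γ₀ ≤ bstar * (1 - ρ)) : EndpointExistence Cn := by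
  obtain ⟨hdrift, hrem, hcap, hsc⟩ := starInputs_of_moduli_NE4 hL hΛ hS hρ0 hρ1 hC hb hγ₀ hγ₀γ hsmall
  exact endpointExistence_of_drift_runConstRemainder_survCont hgen hγ₀ hdrift hrem hcap hsc

end Star

/-! ## §1″ The registered stub currency (K1 v7ᴿ): match-free run rows + (C) from the letters; the ceiling-keyed world closes the match -/

/-- **THE MATCH-FREE RUN ROWS + (C) AT A LEVEL, FROM THE LETTERS** (the hypothesis shape of dag-n24-w1's ceiling-keyed bridge `…K1RunRowsOfBoxAndPartialSums.runRowsText_of_ceilingKeyedRung1_of_rows`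
plus stub 3's (C)): under the moduli + NE4 + `b⋆` on a level `0 < γ₀ ≤ γ` with `2Cγ₀ ≤ b⋆(1−ρ)`, with `b ≡ B := b⋆`, `r = 2Cγ₀∕(1−ρ) + c∕(1−ρ)`, `M = c∕(1−ρ)²` — so the world is to be keyed at
the ceiling `B + r = b⋆ + 2Cγ₀∕(1−ρ) + c∕(1−ρ)` (displayed).  CONDITIONAL on the letters. [cite: Balaban1987RG1, Thm 2 p.259, Thm 3 p.264, §1 pp.263–264, (5.10) p.293, §5 p.298] -/
theorem matchFreeRunRowsCont_of_moduli_NE4 (θ : Node00.Stage13HParams F 2) {γ C c ρ : ℝ} {Λ : ℕ → ℕ → ℝ}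
    (hL : HistLipschitz Λ γ (Node00.betaOfRecord₁₃ F 2 θ.toStage13Params)) (hΛ : FadingMemory C ρ Λ)
    (hS : ScaleShiftRate c ρ γ (Node00.betaOfRecord₁₃ F 2 θ.toStage13Params)) (hρ0 : 0 ≤ ρ) (hρ1 : ρ < 1) (hC : 0 ≤ C)
    {bstar : ℝ} (hb : ∀ u : ℝ, 0 < u → u ≤ γ →
      |betaInf (Node00.betaOfRecord₁₃ F 2 θ.toStage13Params) (fun _ : ℕ => u) - bstar| ≤ C * u / (1 - ρ))
    {γ₀ : ℝ} (hγ₀ : 0 < γ₀) (hγ₀γ : γ₀ ≤ γ) (hsmall : 2 * C * γ₀ ≤ bstar * (1 - ρ)) :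
    ∃ (b : ℕ → ℝ) (r B M : ℝ), RunConstRemainder (Node00.betaOfRecord₁₃ F 2 θ.toStage13Params) b r γ₀ ∧ (∀ k, b k ≤ B) ∧
      B + r = bstar + (2 * C * γ₀ / (1 - ρ) + c / (1 - ρ)) ∧
      (∀ (n : ℕ) (gs : ℕ → ℝ), RGEqH n (Node00.betaOfRecord₁₃ F 2 θ.toStage13Params) gs → Step.InInterval γ₀ n gs →
        ∀ k, k ≤ n → -M ≤ ∑ j ∈ Finset.Ico k n, Node00.betaOfRecord₁₃ F 2 θ.toStage13Params j (prefixOf gs j)) ∧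
      SurvCont (Node00.betaOfRecord₁₃ F 2 θ.toStage13Params) γ₀ := by
  obtain ⟨hi, hiv, hC'⟩ := rows_at_level_of_moduli_NE4 hL hΛ hS hρ0 hρ1 hC hb hγ₀ hγ₀γ hsmall
  exact ⟨fun _ => bstar, _, bstar, _, hi, fun _ => le_rfl, rfl, hiv, hC'⟩

/-- **dag-n24-w1's CEILING-KEYED RUNG 1 AT THE TUPLE + THE LETTERS ⟹ THE REGISTERED STUB-3 TEXT `K1V7RDefs.RunRowsContAtSomeRecord13PWS F`** (K1 v7ᴿ ed.2 `stub_cont13`'s conclusion ∕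
rung 2‴): the world is chosen at the ceiling `b⋆ + 2Cγ₀∕(1−ρ) + c∕(1−ρ)`, so the match `B + r ≤ w.βup` holds by the family's own clause (the pattern of `runRowsText_of_ceilingKeyedRung1_of_rows`),
the rows and (C) come from `matchFreeRunRowsCont_of_moduli_NE4` on a level with `2Cγ₀ ≤ b⋆(1−ρ)`.  Whether rung-1 worlds ARE ceiling-keyed is the rung-1 lanes' question — NOT claimed;
CONDITIONAL on both displayed hypotheses; NO stub proved. [cite: Balaban1987RG1, Thm 3 p.264, §1 pp.263–264, (5.10) p.293; Balaban1989LargeFieldII, Thm 1 p.355 (bookkeeping)] -/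
theorem runRowsContAtSomeRecord13PWS_of_ceilingKeyedRung1_moduli_NE4 (θ : Node00.Stage13HParams F 2) (h : θ.Provisos₁₃SepCoPH F 2)
    (hU : θ.ZhUnity F 2 ∧ θ.SlotsNondegenerate₁₃ F 2) (hθ : θ.Admissible F 2)
    (hfam : ∀ c : ℝ, ∃ w : WorldP, c ≤ w.βup ∧ RecordS F θ h w ∧ ∀ P : B12.RunParams, Nodes (leavesP w P))
    {γ C c ρ : ℝ} {Λ : ℕ → ℕ → ℝ}
    (hL : HistLipschitz Λ γ (Node00.betaOfRecord₁₃ F 2 θ.toStage13Params)) (hΛ : FadingMemory C ρ Λ)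
    (hS : ScaleShiftRate c ρ γ (Node00.betaOfRecord₁₃ F 2 θ.toStage13Params)) (hρ0 : 0 ≤ ρ) (hρ1 : ρ < 1) (hC : 0 ≤ C)
    {bstar : ℝ} (hb : ∀ u : ℝ, 0 < u → u ≤ γ →
      |betaInf (Node00.betaOfRecord₁₃ F 2 θ.toStage13Params) (fun _ : ℕ => u) - bstar| ≤ C * u / (1 - ρ))
    {γ₀ : ℝ} (hγ₀ : 0 < γ₀) (hγ₀γ : γ₀ ≤ γ) (hsmall : 2 * C * γ₀ ≤ bstar * (1 - ρ)) :
    RunRowsContAtSomeRecord13PWS F := by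
  obtain ⟨b, r, B, M, hrem, hB, hsum, hps, hsc⟩ := matchFreeRunRowsCont_of_moduli_NE4 θ hL hΛ hS hρ0 hρ1 hC hb hγ₀ hγ₀γ hsmall
  obtain ⟨w, hc, hR, hnodes⟩ := hfam (B + r)
  exact ⟨θ, h, w, hU, hθ, hR, hnodes, b, r, γ₀, B, M, hγ₀, hrem, hB, hc, hps, hsc⟩

/-! ## §2 The as-printed [I] Theorem 2 interface at the tuple ⟹ the rows -/

/-- **THE AS-PRINTED INTERFACE AT THE TUPLE SUPPLIES K1⁸'s ROWS, NE4-FREE.**  If the record's β at `θ` is the β-field of a `B12BetaAsPrinted.Setting S` (`S.β = β_θ`) carrying the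
statement-exact `Theorem2Statement S hL` (a HYPOTHESIS — stated without proof in print), prover 1's binder `hrg` on ]0, γ_U] and node U2's moduli `HistLipschitz Λ γ_U S.β` +
`FadingMemory C ρ Λ`, then `RunRowsCont13 F θ` (`rowsTriple_of_typedTheorem2_fadingMemory` read through `runRowsCont13_iff_inline`).  CONDITIONAL; nothing of Bałaban's β asserted.
[cite: Balaban1987RG1, Thm 2 (0.31) p.259, Thm 3 p.264, §1 pp.263–264, (5.10) p.293, §5 p.298] -/
theorem runRowsCont13_of_typedTheorem2 (θ : Node00.Stage13HParams F 2) (S : Setting)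
    (hSβ : S.β = Node00.betaOfRecord₁₃ F 2 θ.toStage13Params) {hL : Odd S.L ∧ 1 < S.L} (hT : Theorem2Statement S hL)
    {γU C ρ : ℝ} {Λ : ℕ → ℕ → ℝ} (hγU : 0 < γU) (hρ0 : 0 ≤ ρ) (hρ1 : ρ < 1) (hC : 0 ≤ C)
    (hrg : ∀ P : B12.RunParams, Step.InInterval γU P.K (S.cpl P) → RGEqH P.K S.β (S.cpl P))
    (hLip : HistLipschitz Λ γU S.β) (hΛ : FadingMemory C ρ Λ) :
    RunRowsCont13 F θ := by
  obtain ⟨b, r, γ₀, M, hγ₀, -, h⟩ := rowsTriple_of_typedTheorem2_fadingMemory hT hγU hρ0 hρ1 hC hrg hLip hΛ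
  rw [hSβ] at h
  exact (runRowsCont13_iff_inline F θ).mpr ⟨b, r, γ₀, M, hγ₀, h⟩

/-- **WITH NE4: the as-printed interface + `ScaleShiftRate` ⟹ the rows with the CONSTANT remainder sequence `b ≡ b⋆ > 0`** (`rowsTriple_of_typedTheorem2_NE4`).  CONDITIONAL.
[cite: Balaban1987RG1, Thm 2 (0.31) p.259, Thm 3 p.264, §1 pp.263–264, (5.10) p.293, §5 p.298] -/
theorem runRowsCont13_of_typedTheorem2_NE4 (θ : Node00.Stage13HParams F 2) (S : Setting)
    (hSβ : S.β = Node00.betaOfRecord₁₃ F 2 θ.toStage13Params) {hL : Odd S.L ∧ 1 < S.L} (hT : Theorem2Statement S hL)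
    {γU C c ρ : ℝ} {Λ : ℕ → ℕ → ℝ} (hγU : 0 < γU) (hρ0 : 0 ≤ ρ) (hρ1 : ρ < 1) (hC : 0 ≤ C)
    (hrg : ∀ P : B12.RunParams, Step.InInterval γU P.K (S.cpl P) → RGEqH P.K S.β (S.cpl P))
    (hLip : HistLipschitz Λ γU S.β) (hΛ : FadingMemory C ρ Λ) (hS : ScaleShiftRate c ρ γU S.β) :
    ∃ bstar : ℝ, 0 < bstar ∧ (∀ u : ℝ, 0 < u → u ≤ γU → |betaInf S.β (fun _ : ℕ => u) - bstar| ≤ C * u / (1 - ρ)) ∧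
      ∃ γ₀ : ℝ, 0 < γ₀ ∧ γ₀ ≤ γU ∧
        (∀ (n : ℕ) (gs : ℕ → ℝ), RGEqH n (Node00.betaOfRecord₁₃ F 2 θ.toStage13Params) gs → Step.InInterval γ₀ n gs →
          ∀ k, k ≤ n → |Node00.betaOfRecord₁₃ F 2 θ.toStage13Params k (prefixOf gs k) - bstar| ≤ 2 * C * γ₀ / (1 - ρ) + c / (1 - ρ)) ∧
        RunRowsCont13 F θ := by
  obtain ⟨bstar, hpos, hb, γ₀, hγ₀, hγ₀U, h⟩ := rowsTriple_of_typedTheorem2_NE4 hT hγU hρ0 hρ1 hC hrg hLip hΛ hS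
  rw [hSβ] at h
  obtain ⟨hi, hiv, hC'⟩ := h
  exact ⟨bstar, hpos, hb, γ₀, hγ₀, hγ₀U, hi, (runRowsCont13_iff_inline F θ).mpr ⟨fun _ => bstar, _, γ₀, _, hγ₀, hi, hiv, hC'⟩⟩

/-! ## §3 The programme: the letters at every admissible tuple ⟹ DEF-1's `RowsContAll`, hence K2⁷ (aside) and K1⁸ from K1⁷, BY NAME -/

/-- **THE LETTERS AT EVERY ADMISSIBLE TUPLE WITH PROVISOS ⟹ THE SUPPLIER PROGRAMME `RowsContAll`** (DEF-1's `rowsContAll_of_adm` BY NAME on the NE4-free road; unity, (B), window unused).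
The hypothesis is a DISPLAYED ∀θ letter — NOT printed, inhabited nowhere here.  CONDITIONAL. [cite: Balaban1987RG1, Thm 2 (0.31) p.259, Thm 3 p.264, §1 pp.263–264, §5 p.298] -/
theorem rowsContAll_of_moduliRunsAll
    (h : ∀ (F : T4Family) (θ : Node00.Stage13HParams F 2), θ.Provisos₁₃SepCoPH F 2 → θ.Admissible F 2 →
      ∃ (γ C ρ s s' : ℝ) (Λ : ℕ → ℕ → ℝ), HistLipschitz Λ γ (Node00.betaOfRecord₁₃ F 2 θ.toStage13Params) ∧ FadingMemory C ρ Λ ∧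
        0 ≤ ρ ∧ ρ < 1 ∧ 0 ≤ C ∧ 0 < γ ∧ 0 < s ∧
        ∀ K : ℕ, ∃ r : ℕ → ℝ, RGEqH K (Node00.betaOfRecord₁₃ F 2 θ.toStage13Params) r ∧ Step.InInterval γ K r ∧
          Step.Discrete031 s s' K (r K) r) :
    RowsContAll :=
  rowsContAll_of_adm fun F θ hP hθ => by
    obtain ⟨γ, C, ρ, s, s', Λ, hL, hΛ, hρ0, hρ1, hC, hγ, hs, hruns⟩ := h F θ hP hθ
    exact runRowsCont13_of_moduli_runs θ hL hΛ hρ0 hρ1 hC hγ hs hruns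

/-- … hence THE ASIDE DECL K2⁷ `…Theses.BalabanUVNodes.EndpointGivenBR13SepCoPH` (stmt-QuantumFields-20543) BY NAME (DEF-1's `endpointGivenBR13SepCoPH_of_rowsContAll`).  CONDITIONAL on the
displayed ∀θ letter; K2⁷ NOT closed. [cite: Balaban1987RG1, Thm 2 p.259 (first sentence), Thm 3 p.264, (5.10) p.293] -/
theorem endpointGivenBR13SepCoPH_of_moduliRunsAll
    (h : ∀ (F : T4Family) (θ : Node00.Stage13HParams F 2), θ.Provisos₁₃SepCoPH F 2 → θ.Admissible F 2 →
      ∃ (γ C ρ s s' : ℝ) (Λ : ℕ → ℕ → ℝ), HistLipschitz Λ γ (Node00.betaOfRecord₁₃ F 2 θ.toStage13Params) ∧ FadingMemory C ρ Λ ∧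
        0 ≤ ρ ∧ ρ < 1 ∧ 0 ≤ C ∧ 0 < γ ∧ 0 < s ∧
        ∀ K : ℕ, ∃ r : ℕ → ℝ, RGEqH K (Node00.betaOfRecord₁₃ F 2 θ.toStage13Params) r ∧ Step.InInterval γ K r ∧
          Step.Discrete031 s s' K (r K) r) :
    EndpointGivenBR13SepCoPH :=
  endpointGivenBR13SepCoPH_of_rowsContAll (rowsContAll_of_moduliRunsAll h)

/-- … and K1⁸ `…Theses.BalabanUVNodes.StabilityBRunRowsAtRecordR13SepCoPH` (stmt-QuantumFields-26907) FROM THE ASIDE DECL K1⁷ + the displayed ∀θ letter BY NAME (DEF-1's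
`stabilityBRunRowsAtRecordR13SepCoPH_of_k17_rowsContAll`).  CONDITIONAL on both displayed texts; K1⁸ NOT closed. [cite: Balaban1989LargeFieldII, Thm 1 p.355; Balaban1987RG1, Thm 3 p.264, (5.10) p.293, §1 pp.263–264] -/
theorem stabilityBRunRowsAtRecordR13SepCoPH_of_k17_moduliRunsAll (h1 : StabilityBAtRecordR13SepCoPH)
    (h : ∀ (F : T4Family) (θ : Node00.Stage13HParams F 2), θ.Provisos₁₃SepCoPH F 2 → θ.Admissible F 2 →
      ∃ (γ C ρ s s' : ℝ) (Λ : ℕ → ℕ → ℝ), HistLipschitz Λ γ (Node00.betaOfRecord₁₃ F 2 θ.toStage13Params) ∧ FadingMemory C ρ Λ ∧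
        0 ≤ ρ ∧ ρ < 1 ∧ 0 ≤ C ∧ 0 < γ ∧ 0 < s ∧
        ∀ K : ℕ, ∃ r : ℕ → ℝ, RGEqH K (Node00.betaOfRecord₁₃ F 2 θ.toStage13Params) r ∧ Step.InInterval γ K r ∧
          Step.Discrete031 s s' K (r K) r) :
    StabilityBRunRowsAtRecordR13SepCoPH :=
  stabilityBRunRowsAtRecordR13SepCoPH_of_k17_rowsContAll h1 (rowsContAll_of_moduliRunsAll h)

end

end Summit.QuantumFields.YangMills.Theorems.BalabanUVNodesK1RunRowsOfU2Letters
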